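import Literature.NumberTheory.EllipticCurves.NewformGaloisRepRibetReducible
import Literature.NumberTheory.EllipticCurves.DeligneSerreProp27LevelDescentProofs
import Literature.NumberTheory.EllipticCurves.DeligneSerreProp27Proofs
import Literature.NumberTheory.EllipticCurves.DeligneSerreWeightOneProofs
import Literature.NumberTheory.EllipticCurves.DeligneSerreWeightOneIrreducibleKroneckerWeberProofs
import Literature.NumberTheory.GaloisRepresentations.PadicCharacterCyclotomicFactorProofs
import Literature.NumberTheory.GaloisRepresentations.PadicCharacterLocallyAlgebraicProofs
import Literature.NumberTheory.GaloisRepresentations.KroneckerWeberTheorem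
import Mathlib.Analysis.Normed.Unbundled.SpectralNorm
import Mathlib.Topology.Algebra.Module.FiniteDimension
import Mathlib.FieldTheory.AlgebraicClosure
import HarnessLib

/-!
# Ribet 1977, Thm. (2.3): the `λ`-adic representations attached to newforms are irreducible

This file PROVES the named fact `Ribet1977.thm23_isIrreducible`
(`NewformGaloisRepDeligneProofs.lean`; K. A. Ribet, *Galois representations attached to
eigenforms with Nebentypus*, LNM 601 (1977), §2, Thm. (2.3): "Let `λ` be a prime of `K`. Then
`ρ_λ` is a simple `K_λ`-representation of `G`") as `Ribet1977.thm23_isIrreducible_holds`,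
following the printed proof (LNM 601 pp. 109–110) with the tree's proved ingredients:

1. *(reducible ⇒ two characters)* `exists_contChar_of_not_isIrreducible`: a reducible plane
   representation over a topological field has an invariant line, giving continuous characters
   `φ₁, φ₂` with `φ₁ + φ₂ = tr ρ`, `φ₁ φ₂ = det ρ` ("`(φ₁ * ; 0 φ₂)`").
2. *(class field theory over `ℚ`)* `ContinuousMonoidHom.exists_pow_eq_comp_cyclotomicCharacter`
   (`PadicCharacterCyclotomicFactorProofs`, from the PROVED Kronecker–Weber theorem): a power
   `φ₁^e` factors through the `ℓ`-adic cyclotomic character, `φ₁^e = g ∘ χ_ℓ`.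
3. *(Lang–Serre local algebraicity, "By results of Serre and Lang (see [19, Ch. III])")*
   `GaloisRepresentations.exists_pow_eq_pow_of_isAlgebraic`
   (`PadicCharacterLocallyAlgebraicProofs`, from the `ℓ`-adic six exponentials theorem
   `SixExpPadic.six_exponentials_padic`): the values `g(p) = φ₁(Frob_p)^e` at the primes
   `p ∤ N ℓ` are eigenvalues of Frobenius, hence algebraic, so `g^b = (·)^a` and
   `φ₁(Frob_p)^B = p^A` (`B = e b ≥ 1`, `A ∈ ℤ`) for every `p ∤ N ℓ`.  (We do not need the
   integrality `B ∣ A` of the printed `χ_ℓ^{nᵢ}`; half-integral exponents are excluded by the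
   analytic half directly.)
4. *(transfer to `ℂ`)* along `T : \overline{K_f}^{E} →ₐ[K_f] ℂ` (`IsAlgClosed.lift` on the
   relative algebraic closure of `K_f` in `E`; `K_f` is a number field by the tree's proved
   Deligne–Serre (2.7.3)): the complex roots `α̃, β̃` of `X² - a_p X + ε(p) p^{k-1}` satisfy
   `|α̃|^B = p^A`, `|α̃| |β̃| = p^{k-1}`.
5. *(analytic half, Ribet p. 110, PROVED in `NewformGaloisRepRibetIrreducibleProofs`)*
   `2A ≠ B(k-1)`: `|a_p|² ≥ c_B p^{k-1+1/B}` contradicts the convergence of Rankin's series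
   (`false_of_summable_of_rpow_le`, `DeligneSerre1974.prop51_holds`);
   `2A = B(k-1)`: `ψ = φ₁/φ₂` satisfies `ψ^{B φ(N)} = 1` at all Frobenii, hence everywhere
   (Frobenius density, `absoluteGaloisGroup.monoidHom_eq_of_frobenius'`), so it has open kernel
   and is a Dirichlet character `χ` at Frobenius elements
   (`exists_dirichletCharacter_of_kroneckerWeber` with `KroneckerWeber_holds`), and
   `|a_p|² p^{1-k} = 2 + 2 Re χ(p)` contradicts Rankin (`false_of_rankin_bound_dirichlet`).
6. *(topology)* the module topology of a finite extension `E/ℚ_ℓ` is the topology of the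
   spectral norm (Mathlib `spectralNorm.nontriviallyNormedField`,
   `isModuleTopologyOfFiniteDimensional`), so the normed statement `thm23_normed` gives the
   fact as vendored.

No new definition, no named fact.

## References

* K. A. Ribet, *Galois representations attached to eigenforms with Nebentypus*, LNM 601
  (1977), §2, Thm. (2.3) and its proof (pp. 109–110 of the volume). [Ribet1977Nebentypus]
* J.-P. Serre, *Abelian ℓ-adic representations and elliptic curves* (1968), Ch. III §3.
  [SerreAbelianLadic1968]
* S. Lang, *Introduction to transcendental numbers* (1966), Ch. II. [Lang1966]
-/

noncomputable section

open scoped MatrixGroups ModularForm NumberField Matrix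

open Filter Topology CongruenceSubgroup UpperHalfPlane Polynomial IsDedekindDomain Field NormedSpace

namespace Literature.NumberTheory.EllipticCurves.ModularForms

open Rat.HeightOneSpectrum GaloisRepresentations

/-! ### Step 1: a reducible plane representation gives two continuous characters -/

/-- **Reducible ⇒ `(φ₁ * ; 0 φ₂)`.**  A continuous representation `ρ : G → GL₂(E)` over a
topological field which is not irreducible admits continuous characters `φ₁, φ₂ : G → Eˣ`
with `φ₁ + φ₂ = tr ρ` and `φ₁ φ₂ = det ρ`: `φ₁` is the character of an invariant line `E w`,
`φ₂ = det ρ / φ₁`, and the trace identity is `det(ρ(g) - φ₁(g)) = 0` written out for a `2 × 2`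
matrix. [folklore] -/
theorem exists_contChar_of_not_isIrreducible {G : Type*} [Group G] [TopologicalSpace G]
    [IsTopologicalGroup G] {E : Type*} [Field E] [TopologicalSpace E] [IsTopologicalRing E]
    (ρ : FramedRep G E 2) (h : ¬ FramedRep.IsIrreducible ρ) :
    ∃ φ₁ φ₂ : G →ₜ* Eˣ, ∀ g : G,
      ((φ₁ g : Eˣ) : E) + φ₂ g = ((ρ g : GL (Fin 2) E) : Matrix (Fin 2) (Fin 2) E).trace ∧
      ((φ₁ g : Eˣ) : E) * φ₂ g = ((ρ g : GL (Fin 2) E) : Matrix (Fin 2) (Fin 2) E).det := by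
  classical
  set R : Representation E G (Fin 2 → E) := FramedRep.toRepresentation ρ with hRdef
  have hRapply : ∀ g v, R g v = ((ρ g : GL (Fin 2) E) : Matrix (Fin 2) (Fin 2) E) *ᵥ v :=
    fun g v => rfl
  -- a proper non-trivial subrepresentation
  have hnt : Nontrivial (Subrepresentation R) := by
    refine ⟨⊥, ⊤, fun h' => ?_⟩
    have := congrArg Subrepresentation.toSubmodule h'
    exact bot_ne_top (α := Submodule E (Fin 2 → E)) this
  obtain ⟨W, hWbot, hWtop⟩ : ∃ W : Subrepresentation R, W ≠ ⊥ ∧ W ≠ ⊤ := by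
    by_contra! h'
    exact h { toNontrivial := hnt, eq_bot_or_eq_top := fun W => (em (W = ⊥)).imp_right (h' W) }
  set U : Submodule E (Fin 2 → E) := W.toSubmodule with hU
  -- a non-zero vector of `W`
  obtain ⟨w, hwW, hw0⟩ : ∃ w ∈ U, w ≠ 0 := by
    by_contra! h'
    apply hWbot
    apply Subrepresentation.toSubmodule_injective
    change U = ⊥
    rw [Submodule.eq_bot_iff]
    exact h'
  -- `U` is a line
  have hV : Module.finrank E (Fin 2 → E) = 2 := Module.finrank_fin_fun E
  have h1 : Module.finrank E U = 1 := by
    have hpos : 0 < Module.finrank E U := by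
      rw [Module.finrank_pos_iff_exists_ne_zero]
      exact ⟨⟨w, hwW⟩, fun h0 => hw0 (congrArg Subtype.val h0)⟩
    have hlt : Module.finrank E U < 2 :=
      (Submodule.finrank_lt fun h' => hWtop (Subrepresentation.toSubmodule_injective h')).trans_eq hV
    omega
  have hmul : ∀ v ∈ U, ∃ c : E, c • w = v := by
    intro v hv
    have hw0' : (⟨w, hwW⟩ : U) ≠ 0 := fun h0 => hw0 (congrArg Subtype.val h0)
    obtain ⟨c, hc⟩ := (finrank_eq_one_iff_of_nonzero' (⟨w, hwW⟩ : U) hw0').mp h1 ⟨v, hv⟩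
    exact ⟨c, by simpa using congrArg Subtype.val hc⟩
  -- a coordinate where `w` does not vanish, and the eigenvalue function `c`
  obtain ⟨i₀, hi₀⟩ : ∃ i, w i ≠ 0 := by
    by_contra! h'
    exact hw0 (funext h')
  obtain ⟨c, hcdef⟩ : ∃ c : G → E, c = fun g => (R g w) i₀ / w i₀ := ⟨_, rfl⟩
  have hcw : ∀ g, R g w = c g • w := by
    intro g
    obtain ⟨d, hd⟩ := hmul (R g w) (W.apply_mem_toSubmodule g hwW)
    have hdi : d * w i₀ = (R g w) i₀ := by
      have := congrFun hd i₀
      simpa [Pi.smul_apply, smul_eq_mul] using this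
    have hdc : d = c g := by
      rw [hcdef]
      exact (eq_div_iff hi₀).mpr hdi
    rw [← hdc, hd]
  have hRinj : ∀ g, Function.Injective (R g) := by
    intro g v v' hvv'
    have := congrArg (R g⁻¹) hvv'
    rwa [← Module.End.mul_apply, ← map_mul, inv_mul_cancel, map_one, Module.End.one_apply,
      ← Module.End.mul_apply, ← map_mul, inv_mul_cancel, map_one, Module.End.one_apply] at this
  have hc0 : ∀ g, c g ≠ 0 := by
    intro g hg
    have h0 : R g w = 0 := by rw [hcw, hg, zero_smul]
    exact hw0 (hRinj g (by rw [h0, map_zero]))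
  have hcmul : ∀ g g', c (g * g') = c g * c g' := by
    intro g g'
    have e1 : R (g * g') w = (c g * c g') • w := by
      rw [map_mul, Module.End.mul_apply, hcw g', map_smul, hcw g, smul_smul, mul_comm]
    rw [hcw] at e1
    exact smul_left_injective E hw0 e1
  have hc1 : c 1 = 1 := by
    have e1 : R 1 w = (1 : E) • w := by rw [map_one, Module.End.one_apply, one_smul]
    rw [hcw] at e1
    exact smul_left_injective E hw0 e1
  -- continuity of `c`
  have hMc : Continuous fun g => ((ρ g : GL (Fin 2) E) : Matrix (Fin 2) (Fin 2) E) :=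
    Units.continuous_val.comp ρ.continuous
  have hcc : Continuous c := by
    have h1 : Continuous fun g => (((ρ g : GL (Fin 2) E) : Matrix (Fin 2) (Fin 2) E) *ᵥ w) i₀ :=
      (continuous_apply i₀).comp (hMc.matrix_mulVec continuous_const)
    rw [hcdef]
    exact h1.div_const _
  -- the character `φ₁`
  let φ₁m : G →* Eˣ :=
    { toFun := fun g => Units.mk0 (c g) (hc0 g)
      map_one' := Units.ext hc1
      map_mul' := fun g g' => Units.ext (hcmul g g') }
  have hφ₁m : ∀ g, ((φ₁m g : Eˣ) : E) = c g := fun g => rfl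
  have hφ₁c : Continuous φ₁m := by
    refine Units.continuous_iff.mpr ⟨hcc, ?_⟩
    have : (fun g => (((φ₁m g)⁻¹ : Eˣ) : E)) = fun g => c g⁻¹ := by
      funext g; rw [← map_inv]; rfl
    rw [this]
    exact hcc.comp continuous_inv
  -- the character `φ₂ = det ρ / φ₁`
  let detu : G →* Eˣ := (Matrix.GeneralLinearGroup.det).comp ρ.toMonoidHom
  have hdetu : ∀ g, ((detu g : Eˣ) : E) = ((ρ g : GL (Fin 2) E) : Matrix (Fin 2) (Fin 2) E).det :=
    fun g => rfl
  have hdetc : Continuous detu := Matrix.GeneralLinearGroup.continuous_det.comp ρ.continuous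
  let φ₂m : G →* Eˣ := detu * φ₁m⁻¹
  have hφ₂m : ∀ g, φ₂m g = detu g * (φ₁m g)⁻¹ := fun g => rfl
  have hφ₂c : Continuous φ₂m := by
    have : (φ₂m : G → Eˣ) = fun g => detu g * (φ₁m g)⁻¹ := funext hφ₂m
    rw [this]
    exact hdetc.mul hφ₁c.inv
  refine ⟨⟨φ₁m, hφ₁c⟩, ⟨φ₂m, hφ₂c⟩, fun g => ⟨?_, ?_⟩⟩
  · -- trace: `det (M - c • 1) = 0` for the `2 × 2` matrix `M = ρ g`
    change c g + ((φ₂m g : Eˣ) : E) = _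
    set M : Matrix (Fin 2) (Fin 2) E := ((ρ g : GL (Fin 2) E) : Matrix (Fin 2) (Fin 2) E) with hM
    have hker : ∃ v ≠ 0, (M - c g • (1 : Matrix (Fin 2) (Fin 2) E)) *ᵥ v = 0 := by
      refine ⟨w, hw0, ?_⟩
      rw [Matrix.sub_mulVec, Matrix.smul_mulVec, Matrix.one_mulVec, ← hRapply, hcw, sub_self]
    have hdet0 : (M - c g • (1 : Matrix (Fin 2) (Fin 2) E)).det = 0 :=
      Matrix.exists_mulVec_eq_zero_iff.mp hker
    rw [Matrix.det_fin_two] at hdet0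
    simp only [Matrix.sub_apply, Matrix.smul_apply, Matrix.one_apply_eq, Matrix.one_apply_ne
      (by decide : (0 : Fin 2) ≠ 1), Matrix.one_apply_ne (by decide : (1 : Fin 2) ≠ 0),
      smul_eq_mul, mul_one, mul_zero, sub_zero] at hdet0
    have hφ₂ : ((φ₂m g : Eˣ) : E) = M.det * (c g)⁻¹ := by
      rw [hφ₂m, Units.val_mul, Units.val_inv_eq_inv_val, hdetu, hφ₁m]
    rw [hφ₂, Matrix.trace_fin_two, Matrix.det_fin_two]
    have hc := hc0 g
    field_simp
    linear_combination hdet0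
  · -- determinant
    change c g * ((φ₂m g : Eˣ) : E) = _
    rw [hφ₂m, Units.val_mul, Units.val_inv_eq_inv_val, hdetu, hφ₁m,
      mul_comm, inv_mul_cancel_right₀ (hc0 g)]

/-! ### Step 5: two elementary estimates for the analytic half -/

/-- **Unbalanced absolute values.**  If `|u|^B = p^{A₁}`, `|w|^B = p^{A₂}` with integers
`A₁ ≥ A₂ + 1`, `A₁ + A₂ = B m`, `B ≥ 1`, `p ≥ 2`, then
`|u + w|² ≥ (1 - 2^{-1/B})² p^{m + 1/B}` (`|u + w| ≥ |u| - |w| ≥ |u|(1 - p^{-1/B})` and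
`|u|² = p^{2A₁/B} ≥ p^{m+1/B}`). [folklore] -/
theorem sq_norm_add_ge_of_unbalanced {p : ℕ} (hp : 2 ≤ p) {u w : ℂ} {B : ℕ} (hB : 0 < B)
    {A₁ A₂ : ℤ} {m : ℕ} (hu : ‖u‖ ^ B = (p : ℝ) ^ A₁) (hw : ‖w‖ ^ B = (p : ℝ) ^ A₂)
    (h12 : A₂ + 1 ≤ A₁) (hsum : A₁ + A₂ = (B : ℤ) * m) :
    (1 - (2 : ℝ) ^ (-(1 / (B : ℝ)))) ^ 2 * (p : ℝ) ^ ((m : ℝ) + 1 / B) ≤ ‖u + w‖ ^ 2 := by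
  have hp0 : (0 : ℝ) < p := by exact_mod_cast (show 0 < p by omega)
  have hp1 : (1 : ℝ) ≤ p := by exact_mod_cast (show 1 ≤ p by omega)
  have hp2 : (2 : ℝ) ≤ p := by exact_mod_cast hp
  have hB0 : (B : ℝ) ≠ 0 := by exact_mod_cast hB.ne'
  have hBpos : (0 : ℝ) < B := by exact_mod_cast hB
  -- `|u| = p^{A₁/B}`, `|w| = p^{A₂/B}`
  have hroot : ∀ {x : ℝ} {A : ℤ}, 0 ≤ x → x ^ B = (p : ℝ) ^ A → x = (p : ℝ) ^ ((A : ℝ) / B) := by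
    intro x A hx hxB
    have h1 : (x ^ B) ^ ((B : ℝ)⁻¹) = x := Real.pow_rpow_inv_natCast hx hB.ne'
    rw [← h1, hxB, ← Real.rpow_intCast, ← Real.rpow_mul hp0.le, div_eq_mul_inv]
  have hX : ‖u‖ = (p : ℝ) ^ ((A₁ : ℝ) / B) := hroot (norm_nonneg _) hu
  have hY : ‖w‖ = (p : ℝ) ^ ((A₂ : ℝ) / B) := hroot (norm_nonneg _) hw
  -- `|w| ≤ |u| 2^{-1/B}`
  have hYX : ‖w‖ ≤ ‖u‖ * (2 : ℝ) ^ (-(1 / (B : ℝ))) := by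
    have h1 : ‖w‖ ≤ (p : ℝ) ^ (((A₁ : ℝ) - 1) / B) := by
      rw [hY]
      refine Real.rpow_le_rpow_of_exponent_le hp1 ?_
      have : (A₂ : ℝ) ≤ (A₁ : ℝ) - 1 := by exact_mod_cast (by omega : A₂ ≤ A₁ - 1)
      exact div_le_div_of_nonneg_right this hBpos.le
    have h2 : (p : ℝ) ^ (((A₁ : ℝ) - 1) / B) = ‖u‖ * (p : ℝ) ^ (-(1 / (B : ℝ))) := by
      rw [hX, ← Real.rpow_add hp0]
      congr 1
      field_simp
      ring
    have h3 : (p : ℝ) ^ (-(1 / (B : ℝ))) ≤ (2 : ℝ) ^ (-(1 / (B : ℝ))) :=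
      Real.rpow_le_rpow_of_nonpos (by norm_num) hp2 (by
        rw [neg_nonpos]; positivity)
    calc ‖w‖ ≤ ‖u‖ * (p : ℝ) ^ (-(1 / (B : ℝ))) := h1.trans_eq h2
      _ ≤ ‖u‖ * (2 : ℝ) ^ (-(1 / (B : ℝ))) := mul_le_mul_of_nonneg_left h3 (norm_nonneg _)
  -- `|u + w| ≥ |u| (1 - 2^{-1/B}) ≥ 0`
  have hθ : 0 ≤ 1 - (2 : ℝ) ^ (-(1 / (B : ℝ))) := by
    rw [sub_nonneg]
    exact Real.rpow_le_one_of_one_le_of_nonpos (by norm_num) (by rw [neg_nonpos]; positivity)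
  have hlow : ‖u‖ * (1 - (2 : ℝ) ^ (-(1 / (B : ℝ)))) ≤ ‖u + w‖ := by
    have h1 : ‖u‖ - ‖w‖ ≤ ‖u + w‖ := by
      have := norm_sub_norm_le u (-w)
      rwa [norm_neg, sub_neg_eq_add] at this
    nlinarith [hYX, norm_nonneg u]
  -- `|u|² ≥ p^{m + 1/B}`
  have hX2 : (p : ℝ) ^ ((m : ℝ) + 1 / B) ≤ ‖u‖ ^ 2 := by
    rw [hX, ← Real.rpow_natCast, ← Real.rpow_mul hp0.le]
    refine Real.rpow_le_rpow_of_exponent_le hp1 ?_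
    have h1 : ((B : ℝ) * m + 1) ≤ 2 * (A₁ : ℝ) := by
      have : (B : ℤ) * m + 1 ≤ 2 * A₁ := by omega
      exact_mod_cast this
    rw [div_mul_eq_mul_div, le_div_iff₀ hBpos, add_mul, one_div, inv_mul_cancel₀ hB0]
    push_cast
    linarith [h1]
  have h0 : 0 ≤ ‖u‖ * (1 - (2 : ℝ) ^ (-(1 / (B : ℝ)))) := mul_nonneg (norm_nonneg _) hθ
  calc (1 - (2 : ℝ) ^ (-(1 / (B : ℝ)))) ^ 2 * (p : ℝ) ^ ((m : ℝ) + 1 / B)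
      ≤ (1 - (2 : ℝ) ^ (-(1 / (B : ℝ)))) ^ 2 * ‖u‖ ^ 2 :=
        mul_le_mul_of_nonneg_left hX2 (by positivity)
    _ = (‖u‖ * (1 - (2 : ℝ) ^ (-(1 / (B : ℝ))))) ^ 2 := by ring
    _ ≤ ‖u + w‖ ^ 2 := pow_le_pow_left₀ h0 hlow 2

/-- **Balanced absolute values.**  If `|u|^B = p^{A}`, `|u| |w| = p^m` with `2A = B m`,
`B ≥ 1`, then `|u| = |w|`, and `|u + w|² = p^m (2 + 2 Re(u w⁻¹))` with `|u w⁻¹| = 1`.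
[folklore] -/
theorem sq_norm_add_eq_of_balanced {p : ℕ} (hp : 2 ≤ p) {u w : ℂ} {B : ℕ} (hB : 0 < B)
    {A : ℤ} {m : ℕ} (hu : ‖u‖ ^ B = (p : ℝ) ^ A) (huw : ‖u‖ * ‖w‖ = (p : ℝ) ^ m)
    (hbal : 2 * A = (B : ℤ) * m) :
    ‖u * w⁻¹‖ = 1 ∧ ‖u + w‖ ^ 2 = (p : ℝ) ^ m * (2 + 2 * (u * w⁻¹).re) := by
  have hp0 : (0 : ℝ) < p := by exact_mod_cast (show 0 < p by omega)
  have hX0 : 0 < ‖u‖ := by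
    rcases (norm_nonneg u).lt_or_eq with h | h
    · exact h
    · exfalso
      have : (0 : ℝ) < ‖u‖ ^ B := by rw [hu]; exact zpow_pos hp0 _
      rw [← h, zero_pow hB.ne'] at this
      exact lt_irrefl _ this
  have hXY : ‖u‖ = ‖w‖ := by
    have eL : ‖u‖ ^ B * ‖u‖ ^ B = (p : ℝ) ^ (A + A) := by rw [hu, ← zpow_add₀ hp0.ne']
    have eR : ‖u‖ ^ B * ‖w‖ ^ B = (p : ℝ) ^ ((m : ℤ) * B) := by
      rw [← mul_pow, huw, zpow_mul, zpow_natCast, zpow_natCast]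
    have e : ‖u‖ ^ B * ‖u‖ ^ B = ‖u‖ ^ B * ‖w‖ ^ B := by
      rw [eL, eR]; congr 1; linarith
    have e' : ‖u‖ ^ B = ‖w‖ ^ B := mul_left_cancel₀ (pow_ne_zero _ hX0.ne') e
    exact (pow_left_inj₀ (norm_nonneg _) (norm_nonneg _) hB.ne').mp e'
  have hw0 : w ≠ 0 := norm_pos_iff.mp (hXY ▸ hX0)
  have hũ : ‖u * w⁻¹‖ = 1 := by rw [norm_mul, norm_inv, ← hXY, mul_inv_cancel₀ hX0.ne']
  refine ⟨hũ, ?_⟩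
  have hfac : u + w = w * (u * w⁻¹ + 1) := by field_simp
  have hY2 : ‖w‖ ^ 2 = (p : ℝ) ^ m := by rw [pow_two, ← huw, hXY]
  rw [hfac, norm_mul, mul_pow, hY2, DeligneSerre1974.norm_add_sq_of_norm_eq_one hũ norm_one,
    inv_one, mul_one]

/-! ### The trace of a `2 × 2` matrix from its characteristic polynomial -/

/-- The trace of a `2 × 2` matrix with characteristic polynomial `X² - a X + b` is `a`
(Mathlib `Matrix.trace_eq_neg_charpoly_coeff`). [folklore] -/
theorem trace_eq_of_charpoly_eq_fin_two {R : Type*} [CommRing R] {M : Matrix (Fin 2) (Fin 2) R}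
    {a b : R} (h : M.charpoly = X ^ 2 - C a * X + C b) : M.trace = a := by
  rw [Matrix.trace_eq_neg_charpoly_coeff, h]
  simp

/-! ### The module topology of a finite extension of `ℚ_ℓ` is the spectral-norm topology -/

/-- For a finite extension `E` of `ℚ_ℓ`, the topology of the spectral norm (the unique norm
extending `|·|_ℓ`, Mathlib `spectralNorm.nontriviallyNormedField`) is the `ℚ_ℓ`-module topology
(Mathlib `isModuleTopologyOfFiniteDimensional`). [folklore] -/
theorem spectralNorm_topology_eq_moduleTopology (ℓ : ℕ) [Fact ℓ.Prime] (E : Type) [Field E]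
    [Algebra ℚ_[ℓ] E] [FiniteDimensional ℚ_[ℓ] E] [Algebra.IsAlgebraic ℚ_[ℓ] E] :
    (spectralNorm.nontriviallyNormedField ℚ_[ℓ] E).toNormedField.toMetricSpace.toPseudoMetricSpace.toUniformSpace.toTopologicalSpace =
      moduleTopology ℚ_[ℓ] E := by
  letI := spectralNorm.nontriviallyNormedField ℚ_[ℓ] E
  letI : NormedAlgebra ℚ_[ℓ] E := spectralNorm.normedAlgebra ℚ_[ℓ] E
  haveI : IsModuleTopology ℚ_[ℓ] E := isModuleTopologyOfFiniteDimensional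
  exact IsModuleTopology.eq_moduleTopology'

/-! ### Ribet's theorem over a normed coefficient field -/

namespace Ribet1977

variable {N : ℕ} [NeZero N] {k : ℤ}

set_option maxHeartbeats 1600000 in
/-- **Ribet 1977, Thm. (2.3), normed form.**  For a newform `f ∈ S_k(Γ₁(N))`, `k ≥ 1`, a
prime `ℓ`, a finite extension `E/ℚ_ℓ` with an ultrametric norm extending `|·|_ℓ`, `ι : K_f →+* E`
and a continuous `ρ : Γ_ℚ → GL₂(E)` attached to `f` away from `N ℓ` (`IsGaloisRepOfNewform1`),
`ρ` is irreducible over `E`.  See the module docstring for the proof.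
[cite: Ribet1977Nebentypus, Thm. (2.3) and its proof (LNM 601 pp. 109–110)] -/
theorem thm23_normed {f : CuspForm (Gamma1 N) k} (hk : 1 ≤ k) (hf : IsNewform1 f) (ℓ : ℕ)
    [Fact ℓ.Prime] (E : Type) [NontriviallyNormedField E] [NormedAlgebra ℚ_[ℓ] E]
    [IsUltrametricDist E] [CompleteSpace E] [FiniteDimensional ℚ_[ℓ] E]
    (ι : coeffCharField f →+* E) (ρ : FramedGaloisRep ℚ E 2)
    (hρ : IsGaloisRepOfNewform1 f ι {p | p ∣ N * ℓ} ρ) : FramedRep.IsIrreducible ρ := by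
  classical
  by_contra hirr
  -- ## instances and constants
  haveI : CharZero E := charZero_of_injective_algebraMap (algebraMap ℚ_[ℓ] E).injective
  haveI : IsModuleTopology ℚ_[ℓ] E := isModuleTopologyOfFiniteDimensional
  have hℓ : ℓ.Prime := Fact.out
  haveI : FiniteDimensional ℚ (coeffField f) :=
    (IsNewform1.finiteDimensional_coeffField_of_span_integralLattice1
      (DeligneSerre1974_span_integralLattice1_holds N k)) hf
  haveI : FiniteDimensional ℚ (coeffCharField f) :=
    DeligneSerre1974.finiteDimensional_coeffCharField f
  haveI : NumberField (coeffCharField f) := NumberField.mk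
  letI instKE : Algebra (coeffCharField f) E := ι.toAlgebra
  have hιalg : ∀ x : (coeffCharField f), algebraMap (coeffCharField f) E x = ι x := fun x => rfl
  haveI : IsScalarTower ℚ (coeffCharField f) E := IsScalarTower.of_algebraMap_eq fun x => by
    rw [hιalg, eq_ratCast (algebraMap ℚ (coeffCharField f)) x, map_ratCast, eq_ratCast]
  have htoZ : ∀ {x : E}, IsAlgebraic (coeffCharField f) x → IsAlgebraic ℤ x := fun hx =>
    (IsFractionRing.isAlgebraic_iff ℤ ℚ E).mpr (hx.restrictScalars ℚ)
  obtain ⟨m, hm⟩ : ∃ m : ℕ, ((m : ℕ) : ℤ) = k - 1 := ⟨(k - 1).toNat, Int.toNat_of_nonneg (by omega)⟩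
  have hkm : (k : ℝ) = (m : ℝ) + 1 := by
    have : (k : ℝ) = ((k - 1 : ℤ) : ℝ) + 1 := by push_cast; ring
    rw [this, ← hm]; push_cast; ring
  -- ## Step 1: two continuous characters
  obtain ⟨φ₁, φ₂, hφ⟩ := exists_contChar_of_not_isIrreducible ρ hirr
  -- ## Step 2: a power of `φ₁` factors through `χ_ℓ`
  obtain ⟨e, he, g₁, hg₁⟩ :=
    ContinuousMonoidHom.exists_pow_eq_comp_cyclotomicCharacter (ℓ := ℓ) φ₁
  -- ## Frobenius data at the good primes
  set Sbad : Set (HeightOneSpectrum (𝓞 ℚ)) := {v | ((primesEquiv v : Nat.Primes) : ℕ) ∣ N * ℓ}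
    with hSbad
  have hSbad_fin : Sbad.Finite := by
    have hfin : {n : ℕ | n ∣ N * ℓ}.Finite :=
      (N * ℓ).divisors.finite_toSet.subset fun n hn ↦
        Nat.mem_divisors.mpr ⟨hn, mul_ne_zero (NeZero.ne N) hℓ.ne_zero⟩
    refine (hfin.preimage (f := fun v : HeightOneSpectrum (𝓞 ℚ) ↦ ((primesEquiv v : Nat.Primes) : ℕ))
      fun v _ w _ h ↦ primesEquiv.injective (Subtype.ext h)).subset ?_
    intro v hv
    exact hv
  set aK : ℕ → (coeffCharField f) := fun p => ⟨(qExpansion 1 ⇑f).coeff p, cuspCoeff_mem_coeffCharField f p⟩ with haK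
  set cK : ℕ → (coeffCharField f) := fun p => nebentypusCoeff f p with hcK
  have hfrob : ∀ v ∉ Sbad, ∀ 𝔓 ∈ v.primesAbove, ∀ Φ : absoluteGaloisGroup ℚ,
      IsArithFrobAt (𝓞 ℚ) Φ 𝔓 →
      ((φ₁ Φ : Eˣ) : E) + φ₂ Φ = ι (aK (primesEquiv v : Nat.Primes)) ∧
      ((φ₁ Φ : Eˣ) : E) * φ₂ Φ =
        ι (cK (primesEquiv v : Nat.Primes)) * (((primesEquiv v : Nat.Primes) : ℕ) : E) ^ m ∧
      ((GaloisRep.cyclotomicCharacter ℚ ℓ Φ : ℤ_[ℓ]ˣ) : ℤ_[ℓ]) =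
        (((primesEquiv v : Nat.Primes) : ℕ) : ℤ_[ℓ]) := by
    intro v hvS 𝔓 h𝔓 Φ hΦ
    set p : ℕ := ((primesEquiv v : Nat.Primes) : ℕ) with hpdef
    have hpv : p = natGenerator v := rfl
    have hpNℓ : ¬ p ∣ N * ℓ := hvS
    have hpℓ : ¬ p ∣ ℓ := fun h ↦ hpNℓ (h.mul_left N)
    have hℓv : (ℓ : 𝓞 ℚ) ∉ v.asIdeal := by
      rw [Rat.natCast_mem_asIdeal_iff, ← hpv]
      exact hpℓ
    obtain ⟨-, hchar⟩ := hρ v hpNℓ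
    have hc := hchar 𝔓 h𝔓 Φ hΦ
    rw [← hpdef, map_heckePolynomial_eq f ι p hm] at hc
    have htr := trace_eq_of_charpoly_eq_fin_two hc
    have hdet := Matrix.det_eq_of_charpoly_eq hc
    refine ⟨?_, ?_, ?_⟩
    · rw [(hφ Φ).1]; exact htr
    · rw [(hφ Φ).2]; exact hdet
    · rw [GaloisRep.cyclotomicCharacter_apply_of_isArithFrobAt hℓv h𝔓 hΦ,
        Rat.residueCard_eq_natGenerator, ← hpv]
  -- the eigenvalues of Frobenius are algebraic over `(coeffCharField f)`
  have halgΦ : ∀ v ∉ Sbad, ∀ 𝔓 ∈ v.primesAbove, ∀ Φ : absoluteGaloisGroup ℚ,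
      IsArithFrobAt (𝓞 ℚ) Φ 𝔓 →
      IsAlgebraic (coeffCharField f) ((φ₁ Φ : Eˣ) : E) ∧ IsAlgebraic (coeffCharField f) ((φ₂ Φ : Eˣ) : E) := by
    intro v hvS 𝔓 h𝔓 Φ hΦ
    obtain ⟨htr, hdet, -⟩ := hfrob v hvS 𝔓 h𝔓 Φ hΦ
    set p : ℕ := ((primesEquiv v : Nat.Primes) : ℕ)
    set P : Polynomial (coeffCharField f) := X ^ 2 - C (aK p) * X + C (cK p * (p : (coeffCharField f)) ^ m) with hP
    have hP0 : P ≠ 0 := by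
      have hmon : P.Monic := by rw [hP]; monicity!
      exact hmon.ne_zero
    have heval : ∀ x : E, Polynomial.aeval x P =
        x ^ 2 - ι (aK p) * x + ι (cK p) * (p : E) ^ m := by
      intro x
      simp only [hP, map_add, map_sub, map_mul, map_pow, Polynomial.aeval_X, Polynomial.aeval_C,
        hιalg, map_natCast]
    constructor
    · refine ⟨P, hP0, ?_⟩
      rw [heval, ← htr, ← hdet]; ring
    · refine ⟨P, hP0, ?_⟩
      rw [heval, ← htr, ← hdet]; ring
  -- ## Step 3: local algebraicity of `g₁`
  have hBadℕ : {p : ℕ | p ∣ N * ℓ}.Finite :=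
    (N * ℓ).divisors.finite_toSet.subset fun n hn ↦
      Nat.mem_divisors.mpr ⟨hn, mul_ne_zero (NeZero.ne N) hℓ.ne_zero⟩
  have halg_g : ∀ p : ℕ, p.Prime → p ∉ {p : ℕ | p ∣ N * ℓ} → ∀ u : ℤ_[ℓ]ˣ,
      ((u : ℤ_[ℓ]) : ℚ_[ℓ]) = p → IsAlgebraic ℤ ((g₁ u : Eˣ) : E) := by
    intro p hp hpS u hu
    set v : HeightOneSpectrum (𝓞 ℚ) := primesEquiv.symm ⟨p, hp⟩ with hvdef
    have hvp : (primesEquiv v : Nat.Primes) = ⟨p, hp⟩ := Equiv.apply_symm_apply _ _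
    have hvS : v ∉ Sbad := by
      change ¬ ((primesEquiv v : Nat.Primes) : ℕ) ∣ N * ℓ
      rw [hvp]; exact hpS
    obtain ⟨𝔓, h𝔓⟩ := v.primesAbove_nonempty
    obtain ⟨Φ, hΦ⟩ := HeightOneSpectrum.exists_isArithFrobAt_of_mem_primesAbove_holds h𝔓
    obtain ⟨-, -, hcyc⟩ := hfrob v hvS 𝔓 h𝔓 Φ hΦ
    rw [hvp] at hcyc
    have hu' : u = GaloisRep.cyclotomicCharacter ℚ ℓ Φ := by
      apply Units.ext
      apply Subtype.ext
      rw [hu, hcyc]; simp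
    have hval : ((g₁ u : Eˣ) : E) = ((φ₁ Φ : Eˣ) : E) ^ e := by
      rw [hu', ← hg₁ Φ, Units.val_pow_eq_pow_val]
    rw [hval]
    exact (htoZ (halgΦ v hvS 𝔓 h𝔓 Φ hΦ).1).pow e
  obtain ⟨b, hb, a, hab⟩ := exists_pow_eq_pow_of_isAlgebraic g₁ hBadℕ halg_g
  -- `φ₁(Frob_p)^{e b} = p^a`
  have hpowfrob : ∀ v ∉ Sbad, ∀ 𝔓 ∈ v.primesAbove, ∀ Φ : absoluteGaloisGroup ℚ,
      IsArithFrobAt (𝓞 ℚ) Φ 𝔓 →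
      ((φ₁ Φ : Eˣ) : E) ^ (e * b) = ((((primesEquiv v : Nat.Primes) : ℕ) : E)) ^ a := by
    intro v hvS 𝔓 h𝔓 Φ hΦ
    obtain ⟨-, -, hcyc⟩ := hfrob v hvS 𝔓 h𝔓 Φ hΦ
    rw [pow_mul, ← Units.val_pow_eq_pow_val, hg₁ Φ, hab, hcyc]
    simp
  set B : ℕ := e * b with hBdef
  have hBpos : 0 < B := Nat.mul_pos he hb
  -- ## Step 4: transfer to `ℂ`
  let Acl : IntermediateField (coeffCharField f) E := algebraicClosure (coeffCharField f) E
  have hmemA : ∀ {x : E}, IsAlgebraic (coeffCharField f) x → x ∈ Acl := fun hx => mem_algebraicClosure_iff.mpr hx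
  haveI : Module.IsTorsionFree (coeffCharField f) Acl := DivisionSemiring.to_moduleIsTorsionFree
  haveI : Module.IsTorsionFree (coeffCharField f) ℂ := DivisionSemiring.to_moduleIsTorsionFree
  obtain ⟨T, -⟩ : ∃ _ : Acl →ₐ[(coeffCharField f)] ℂ, True := ⟨IsAlgClosed.lift, trivial⟩
  have hTK : ∀ y : (coeffCharField f), T (algebraMap (coeffCharField f) Acl y) = (y : ℂ) :=
    fun y => T.commutes y
  -- Rankin (Deligne–Serre Prop. 5.1) for `f`
  have hf0 : f ≠ 0 := by
    rintro rfl
    have h1 : IsNormalized (0 : CuspForm (Gamma1 N) k) := hf.2.2.2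
    simp [IsNormalized, CuspForm.coe_zero, UpperHalfPlane.qExpansion_zero] at h1
  obtain ⟨hsumm, C₅, hbound⟩ := DeligneSerre1974.prop51_holds (nebentypus f) f
    (IsNewform1.mem_nebentypusSubspace_nebentypus_holds hf) hf0 (fun p hp _ ↦ hf.2.1 p hp)
  have hrankin : ∀ (s : ℝ) (p : ℕ), p.Prime → ¬ p ∣ N →
      DeligneSerre1974.rankinTerm f s p =
        ‖(qExpansion 1 ⇑f).coeff p‖ ^ 2 * (p : ℝ) ^ (-s) := by
    intro s p hpp hpN
    rw [DeligneSerre1974.rankinTerm, if_pos ⟨hpp, hpN⟩,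
      IsNewform1.heckeEigenvalue_eq_coeff_holds hf hpp]
  have hεnorm : ∀ p : ℕ, p.Prime → ¬ p ∣ N → ‖(nebentypus f (p : ZMod N) : ℂ)‖ = 1 := by
    intro p hpp hpN
    have hcop : p.Coprime N := (Nat.Prime.coprime_iff_not_dvd hpp).mpr hpN
    have hu : ((ZMod.unitOfCoprime p hcop : (ZMod N)ˣ) : ZMod N) = (p : ZMod N) :=
      ZMod.coe_unitOfCoprime p hcop
    rw [← hu]
    exact (nebentypus f).unit_norm_eq_one _
  -- the complex roots at a good prime
  have hroots : ∀ (p : ℕ) (hp : p.Prime), ¬ p ∣ N * ℓ →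
      ∀ 𝔓 ∈ (primesEquiv.symm ⟨p, hp⟩ : HeightOneSpectrum (𝓞 ℚ)).primesAbove,
      ∀ Φ : absoluteGaloisGroup ℚ, IsArithFrobAt (𝓞 ℚ) Φ 𝔓 →
      ∃ u w : ℂ, u + w = (qExpansion 1 ⇑f).coeff p ∧
        ‖u‖ * ‖w‖ = (p : ℝ) ^ m ∧ ‖u‖ ^ B = (p : ℝ) ^ a ∧
        (∀ x : Acl, (x : E) = ((φ₁ Φ : Eˣ) : E) → T x = u) ∧
        (∀ y : Acl, (y : E) = ((φ₂ Φ : Eˣ) : E) → T y = w) := by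
    intro p hp hpNℓ 𝔓 h𝔓 Φ hΦ
    set v : HeightOneSpectrum (𝓞 ℚ) := primesEquiv.symm ⟨p, hp⟩ with hvdef
    have hvp : (primesEquiv v : Nat.Primes) = ⟨p, hp⟩ := Equiv.apply_symm_apply _ _
    have hvS : v ∉ Sbad := by
      change ¬ ((primesEquiv v : Nat.Primes) : ℕ) ∣ N * ℓ
      rw [hvp]; exact hpNℓ
    have hpN : ¬ p ∣ N := fun h ↦ hpNℓ (h.mul_right ℓ)
    obtain ⟨htr, hdet, -⟩ := hfrob v hvS 𝔓 h𝔓 Φ hΦ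
    have hpow := hpowfrob v hvS 𝔓 h𝔓 Φ hΦ
    obtain ⟨hα, hβ⟩ := halgΦ v hvS 𝔓 h𝔓 Φ hΦ
    rw [hvp] at htr hdet hpow
    set α : E := ((φ₁ Φ : Eˣ) : E) with hαdef
    set β : E := ((φ₂ Φ : Eˣ) : E) with hβdef
    set αA : Acl := ⟨α, hmemA hα⟩ with hαA
    set βA : Acl := ⟨β, hmemA hβ⟩ with hβA
    refine ⟨T αA, T βA, ?_, ?_, ?_, ?_, ?_⟩
    · -- sum
      have h1 : αA + βA = algebraMap (coeffCharField f) Acl (aK p) := by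
        apply Subtype.ext
        change α + β = algebraMap (coeffCharField f) E (aK p)
        rw [hιalg]; exact htr
      rw [← map_add, h1, hTK]
    · -- product of absolute values
      have h1 : αA * βA = algebraMap (coeffCharField f) Acl (cK p * (p : (coeffCharField f)) ^ m) := by
        apply Subtype.ext
        change α * β = algebraMap (coeffCharField f) E (cK p * (p : (coeffCharField f)) ^ m)
        rw [hιalg, map_mul, map_pow, map_natCast]; exact hdet
      rw [← norm_mul, ← map_mul, h1, hTK]
      push_cast
      rw [norm_mul, norm_pow, Complex.norm_natCast, hcK, coe_nebentypusCoeff, hεnorm p hp hpN, one_mul]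
    · -- `|u|^B = p^a`
      have hp0 : (p : E) ≠ 0 := Nat.cast_ne_zero.mpr hp.ne_zero
      have h1 : αA ^ B = (p : Acl) ^ a := by
        apply Subtype.ext
        push_cast
        exact hpow
      rw [← norm_pow, ← map_pow, h1, map_zpow₀, map_natCast, norm_zpow, Complex.norm_natCast]
    · intro x hx
      have : x = αA := Subtype.ext hx
      rw [this]
    · intro y hy
      have : y = βA := Subtype.ext hy
      rw [this]
  -- ## Step 5: the analytic half
  by_cases hbal : 2 * a = (B : ℤ) * m
  · -- ### balanced case: `ψ = φ₁/φ₂` has finite order, is a Dirichlet character, Rankin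
    set B' : ℕ := B * Nat.totient N with hB'
    have hB'pos : 0 < B' := Nat.mul_pos hBpos (Nat.totient_pos.mpr (NeZero.pos N))
    let ψm : absoluteGaloisGroup ℚ →* Eˣ := φ₁.toMonoidHom * (φ₂.toMonoidHom)⁻¹
    have hψm : ∀ σ, ψm σ = φ₁ σ * (φ₂ σ)⁻¹ := fun σ => rfl
    have hψc : Continuous ψm := by
      have : (ψm : absoluteGaloisGroup ℚ → Eˣ) = fun σ => φ₁ σ * (φ₂ σ)⁻¹ := funext hψm
      rw [this]
      exact φ₁.continuous.mul φ₂.continuous.inv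
    -- `ε(p)^{φ(N)} = 1` in `(coeffCharField f)`
    have hεtot : ∀ p : ℕ, p.Prime → ¬ p ∣ N → (cK p) ^ Nat.totient N = 1 := by
      intro p hpp hpN
      have hcop : p.Coprime N := (Nat.Prime.coprime_iff_not_dvd hpp).mpr hpN
      apply (algebraMap (coeffCharField f) ℂ).injective
      rw [map_pow, map_one]
      change ((nebentypusCoeff f p : (coeffCharField f)) : ℂ) ^ Nat.totient N = 1
      rw [coe_nebentypusCoeff, ← ZMod.coe_unitOfCoprime p hcop, ← map_pow, ← Units.val_pow_eq_pow_val,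
        ZMod.pow_totient, Units.val_one, map_one]
    -- `ψ^{B'} = 1` at the Frobenius elements
    have hψfrob : ∀ v ∉ Sbad, ∀ 𝔓 ∈ v.primesAbove, ∀ Φ : absoluteGaloisGroup ℚ,
        IsArithFrobAt (𝓞 ℚ) Φ 𝔓 → (ψm ^ B') Φ = (1 : absoluteGaloisGroup ℚ →* Eˣ) Φ := by
      intro v hvS 𝔓 h𝔓 Φ hΦ
      obtain ⟨htr, hdet, -⟩ := hfrob v hvS 𝔓 h𝔓 Φ hΦ
      have hpow := hpowfrob v hvS 𝔓 h𝔓 Φ hΦ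
      set p : ℕ := ((primesEquiv v : Nat.Primes) : ℕ) with hpdef
      have hpp : p.Prime := (primesEquiv v).2
      have hpN : ¬ p ∣ N := fun h ↦ hvS (h.mul_right ℓ)
      rw [MonoidHom.pow_apply, MonoidHom.one_apply, hψm]
      apply Units.ext
      rw [Units.val_pow_eq_pow_val, Units.val_mul, Units.val_inv_eq_inv_val, Units.val_one]
      set α : E := ((φ₁ Φ : Eˣ) : E) with hαdef
      set β : E := ((φ₂ Φ : Eˣ) : E) with hβdef
      have hα0 : α ≠ 0 := (φ₁ Φ).ne_zero
      have hβ0 : β ≠ 0 := (φ₂ Φ).ne_zero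
      have hc0 : ι (cK p) ≠ 0 := by
        intro h0
        rw [h0, zero_mul] at hdet
        exact mul_ne_zero hα0 hβ0 hdet
      have hp0 : (p : E) ≠ 0 := Nat.cast_ne_zero.mpr hpp.ne_zero
      have h2 : α ^ B * α ^ B = (p : E) ^ (m * B) := by
        rw [hpow, ← zpow_add₀ hp0, ← zpow_natCast (p : E) (m * B)]
        congr 1
        push_cast
        linarith
      have hβ : β = ι (cK p) * (p : E) ^ m * α⁻¹ := by
        field_simp
        linear_combination hdet
      have hquot : (α * β⁻¹) ^ B = (ι (cK p))⁻¹ ^ B := by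
        have e1 : α * (ι (cK p) * (p : E) ^ m * α⁻¹)⁻¹ =
            α ^ 2 * ((ι (cK p))⁻¹ * ((p : E) ^ m)⁻¹) := by
          field_simp
        rw [hβ, e1, mul_pow, mul_pow, inv_pow, inv_pow, ← pow_mul, two_mul, pow_add, h2,
          ← pow_mul]
        field_simp
      rw [hB', pow_mul, hquot, ← pow_mul, mul_comm B, pow_mul, inv_pow, ← map_pow,
        hεtot p hpp hpN, map_one, inv_one, one_pow]
    have hψall : ψm ^ B' = 1 := by
      refine absoluteGaloisGroup.monoidHom_eq_of_frobenius' (f := (Units.val : Eˣ → E))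
        Units.val_injective hSbad_fin ?_ ?_ hψfrob
      · have : ((Units.val : Eˣ → E) ∘ ⇑(ψm ^ B')) = fun σ => ((ψm σ : Eˣ) : E) ^ B' := by
          funext σ
          simp only [Function.comp_apply, MonoidHom.pow_apply, Units.val_pow_eq_pow_val]
        rw [this]
        exact (Units.continuous_val.comp hψc).pow B'
      · exact continuous_const
    have hψB : ∀ σ, ψm σ ^ B' = 1 := fun σ => by
      have := congrArg (fun χ : absoluteGaloisGroup ℚ →* Eˣ => χ σ) hψall
      simpa using this
    -- open kernel
    have hker : IsOpen ((ψm.ker : Subgroup (absoluteGaloisGroup ℚ)) :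
        Set (absoluteGaloisGroup ℚ)) := by
      have hfinE : {x : E | x ^ B' = 1}.Finite := by
        refine (Polynomial.nthRoots B' (1 : E)).finite_toSet.subset ?_
        intro x hx
        exact (Polynomial.mem_nthRoots hB'pos).mpr hx
      have hfin : {u : Eˣ | u ^ B' = 1}.Finite := by
        refine Set.Finite.of_finite_image (hfinE.subset ?_) Units.val_injective.injOn
        rintro _ ⟨u, hu, rfl⟩
        have := congrArg Units.val hu
        simpa [Units.val_pow_eq_pow_val] using this
      set V : Set Eˣ := ({u : Eˣ | u ^ B' = 1} \ {1})ᶜ with hV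
      have hVo : IsOpen V := (hfin.subset Set.sdiff_subset).isClosed.isOpen_compl
      have hkerV : ((ψm.ker : Subgroup (absoluteGaloisGroup ℚ)) : Set (absoluteGaloisGroup ℚ)) =
          ψm ⁻¹' V := by
        ext σ
        simp only [SetLike.mem_coe, MonoidHom.mem_ker, Set.mem_preimage, hV, Set.mem_compl_iff,
          Set.mem_sdiff, Set.mem_singleton_iff, Set.mem_setOf_eq, not_and, not_not]
        constructor
        · intro h _; exact h
        · intro h; exact h (hψB σ)
      rw [hkerV]
      exact hVo.preimage hψc
    -- `ψ` composed with `T` is a character `Γ_ℚ → ℂˣ` with open kernel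
    have hψalg : ∀ σ, IsAlgebraic (coeffCharField f) ((ψm σ : Eˣ) : E) := by
      intro σ
      refine ⟨X ^ B' - 1, (Polynomial.monic_X_pow_sub_C (1 : coeffCharField f) hB'pos.ne').ne_zero, ?_⟩
      simp only [map_sub, map_pow, Polynomial.aeval_X, map_one]
      rw [← Units.val_pow_eq_pow_val, hψB σ, Units.val_one, sub_self]
    have hψA0 : ∀ σ, (⟨((ψm σ : Eˣ) : E), hmemA (hψalg σ)⟩ : Acl) ≠ 0 := fun σ h0 =>
      (ψm σ).ne_zero (congrArg Subtype.val h0)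
    have hχC1 : (⟨((ψm 1 : Eˣ) : E), hmemA (hψalg 1)⟩ : Acl) = 1 := Subtype.ext (by simp)
    have hχCmul : ∀ σ τ, (⟨((ψm (σ * τ) : Eˣ) : E), hmemA (hψalg (σ * τ))⟩ : Acl) =
        ⟨((ψm σ : Eˣ) : E), hmemA (hψalg σ)⟩ * ⟨((ψm τ : Eˣ) : E), hmemA (hψalg τ)⟩ :=
      fun σ τ => Subtype.ext (by simp)
    let χCfun : absoluteGaloisGroup ℚ → ℂˣ := fun σ =>
      Units.mk0 (T ⟨((ψm σ : Eˣ) : E), hmemA (hψalg σ)⟩) ((map_ne_zero T).mpr (hψA0 σ))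
    have hχCfun : ∀ σ, ((χCfun σ : ℂˣ) : ℂ) = T ⟨((ψm σ : Eˣ) : E), hmemA (hψalg σ)⟩ :=
      fun σ => rfl
    obtain ⟨χC, hχCval⟩ : ∃ χC : absoluteGaloisGroup ℚ →* ℂˣ,
        ∀ σ, ((χC σ : ℂˣ) : ℂ) = T ⟨((ψm σ : Eˣ) : E), hmemA (hψalg σ)⟩ := by
      refine ⟨MonoidHom.mk' χCfun fun σ τ => ?_, hχCfun⟩
      apply Units.ext
      rw [Units.val_mul, hχCfun, hχCfun, hχCfun, ← map_mul, hχCmul]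
    have hχC : ∀ σ (x : Acl), (x : E) = ((ψm σ : Eˣ) : E) → ((χC σ : ℂˣ) : ℂ) = T x := by
      intro σ x hx
      have : x = ⟨((ψm σ : Eˣ) : E), hmemA (hψalg σ)⟩ := Subtype.ext hx
      rw [this, hχCval]
    have hkerC : IsOpen ((χC.ker : Subgroup (absoluteGaloisGroup ℚ)) :
        Set (absoluteGaloisGroup ℚ)) := by
      refine Subgroup.isOpen_mono ?_ hker
      intro σ hσ
      rw [MonoidHom.mem_ker] at hσ ⊢
      apply Units.ext
      have h1 : ((1 : Acl) : E) = ((ψm σ : Eˣ) : E) := by rw [hσ, Units.val_one, OneMemClass.coe_one]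
      rw [hχC σ 1 h1, map_one, Units.val_one]
    obtain ⟨m₀, hm₀, χ, hχ⟩ := exists_dirichletCharacter_of_kroneckerWeber KroneckerWeber_holds χC hkerC
    -- the Rankin contradiction
    have hBad : {p : ℕ | p ∣ N * ℓ * m₀}.Finite :=
      (N * ℓ * m₀).divisors.finite_toSet.subset fun n hn ↦
        Nat.mem_divisors.mpr ⟨hn, mul_ne_zero (mul_ne_zero (NeZero.ne N) hℓ.ne_zero) (NeZero.ne m₀)⟩
    refine false_of_rankin_bound_dirichlet χ hBad
      (T := fun σ p ↦ DeligneSerre1974.rankinTerm f (σ + ((k : ℝ) - 1)) p)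
      (fun σ p ↦ DeligneSerre1974.rankinTerm_nonneg f _ p) ?_ (fun σ hσ ↦ hsumm _ (by linarith))
      (C := C₅) ?_
    · intro σ hσ p hpp hpB
      have hpNℓ : ¬ p ∣ N * ℓ := fun h ↦ hpB (h.mul_right m₀)
      have hpN : ¬ p ∣ N := fun h ↦ hpNℓ (h.mul_right ℓ)
      have hpm₀ : ¬ p ∣ m₀ := fun h ↦ hpB (h.mul_left (N * ℓ))
      set v : HeightOneSpectrum (𝓞 ℚ) := primesEquiv.symm ⟨p, hpp⟩ with hvdef
      obtain ⟨𝔓, h𝔓⟩ := v.primesAbove_nonempty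
      obtain ⟨Φ, hΦ⟩ := HeightOneSpectrum.exists_isArithFrobAt_of_mem_primesAbove_holds h𝔓
      obtain ⟨u, w, hsum, hprod, hpowu, hlinkα, hlinkβ⟩ := hroots p hpp hpNℓ 𝔓 h𝔓 Φ hΦ
      obtain ⟨hunit, hsq⟩ := sq_norm_add_eq_of_balanced hpp.two_le hBpos hpowu hprod hbal
      -- `χ(p) = u w⁻¹`
      have hw0 : w ≠ 0 := by
        intro h0; rw [h0, inv_zero, mul_zero, norm_zero] at hunit; exact zero_ne_one hunit
      obtain ⟨hα, hβ⟩ := halgΦ v (by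
        change ¬ ((primesEquiv v : Nat.Primes) : ℕ) ∣ N * ℓ
        rw [hvdef, Equiv.apply_symm_apply]; exact hpNℓ) 𝔓 h𝔓 Φ hΦ
      set αA : Acl := ⟨((φ₁ Φ : Eˣ) : E), hmemA hα⟩ with hαA
      set βA : Acl := ⟨((φ₂ Φ : Eˣ) : E), hmemA hβ⟩ with hβA
      have hχp : χ (p : ZMod m₀) = u * w⁻¹ := by
        rw [← hχ p hpp hpm₀ 𝔓 h𝔓 Φ hΦ]
        have hx : ((αA * βA⁻¹ : Acl) : E) = ((ψm Φ : Eˣ) : E) := by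
          rw [hψm, Units.val_mul, Units.val_inv_eq_inv_val]
          push_cast
          rfl
        rw [hχC Φ _ hx, map_mul, map_inv₀, hlinkα αA rfl, hlinkβ βA rfl]
      -- the Rankin term
      have hp0 : (0 : ℝ) < p := by exact_mod_cast hpp.pos
      change DeligneSerre1974.rankinTerm f (σ + ((k : ℝ) - 1)) p = _
      have hexp : (p : ℝ) ^ (m : ℕ) * (p : ℝ) ^ (-(σ + ((k : ℝ) - 1))) = (p : ℝ) ^ (-σ) := by
        rw [← Real.rpow_natCast, ← Real.rpow_add hp0]
        congr 1
        rw [hkm]; ring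
      rw [hrankin _ p hpp hpN, ← hsum, hsq, hχp, mul_comm ((p : ℝ) ^ m), mul_assoc, hexp]
    · have htend : Tendsto (fun σ : ℝ ↦ σ + ((k : ℝ) - 1)) (𝓝[>] 1) (𝓝[>] (k : ℝ)) := by
        refine tendsto_nhdsWithin_of_tendsto_nhds_of_eventually_within _ ?_ ?_
        · have : Tendsto (fun σ : ℝ ↦ σ + ((k : ℝ) - 1)) (𝓝 1) (𝓝 (1 + ((k : ℝ) - 1))) :=
            tendsto_id.add tendsto_const_nhds
          rw [show (1 : ℝ) + ((k : ℝ) - 1) = k by ring] at this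
          exact this.mono_left nhdsWithin_le_nhds
        · filter_upwards [self_mem_nhdsWithin] with σ hσ
          change (k : ℝ) < σ + ((k : ℝ) - 1)
          have hσ' : (1 : ℝ) < σ := hσ
          linarith
      refine (htend.eventually hbound).mono fun σ hσ ↦ ?_
      have : σ + ((k : ℝ) - 1) - k = σ - 1 := by ring
      rw [this] at hσ
      exact hσ
  · -- ### unbalanced case: `|a_p|² ≥ c_B p^{k-1+1/B}` against the convergence of Rankin's series
    set cst : ℝ := (1 - (2 : ℝ) ^ (-(1 / (B : ℝ)))) ^ 2 with hcst
    have hcst0 : 0 < cst := by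
      have h1 : (2 : ℝ) ^ (-(1 / (B : ℝ))) < 1 :=
        Real.rpow_lt_one_of_one_lt_of_neg (by norm_num) (by
          rw [neg_lt_zero]; positivity)
      have h2 : 0 < 1 - (2 : ℝ) ^ (-(1 / (B : ℝ))) := by linarith
      positivity
    set s₀ : ℝ := (k : ℝ) + 1 / (2 * (B : ℝ)) with hs₀
    have hBr : (0 : ℝ) < B := by exact_mod_cast hBpos
    have hfrac : (0 : ℝ) < 1 / (2 * (B : ℝ)) := by positivity
    have hs₀k : (k : ℝ) < s₀ := by rw [hs₀]; linarith
    refine false_of_summable_of_rpow_le hBadℕ (T := DeligneSerre1974.rankinTerm f s₀)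
      (fun p ↦ DeligneSerre1974.rankinTerm_nonneg f _ p) (c := cst) (t := -1 + 1 / (2 * (B : ℝ)))
      hcst0 (by linarith) ?_ (hsumm _ hs₀k)
    intro p hpp hpNℓ
    have hpN : ¬ p ∣ N := fun h ↦ hpNℓ (h.mul_right ℓ)
    have hp0 : (0 : ℝ) < p := by exact_mod_cast hpp.pos
    set v : HeightOneSpectrum (𝓞 ℚ) := primesEquiv.symm ⟨p, hpp⟩ with hvdef
    obtain ⟨𝔓, h𝔓⟩ := v.primesAbove_nonempty
    obtain ⟨Φ, hΦ⟩ := HeightOneSpectrum.exists_isArithFrobAt_of_mem_primesAbove_holds h𝔓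
    obtain ⟨u, w, hsum, hprod, hpowu, -, -⟩ := hroots p hpp hpNℓ 𝔓 h𝔓 Φ hΦ
    -- `|w|^B = p^{Bm - a}`
    have hpoww : ‖w‖ ^ B = (p : ℝ) ^ ((B : ℤ) * m - a) := by
      have h1 : ‖u‖ ^ B * ‖w‖ ^ B = (p : ℝ) ^ ((B : ℤ) * m) := by
        rw [← mul_pow, hprod, zpow_mul', zpow_natCast, zpow_natCast]
      rw [hpowu] at h1
      rw [zpow_sub₀ hp0.ne', eq_div_iff (zpow_ne_zero _ hp0.ne'), mul_comm]
      exact h1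
    -- the elementary estimate
    have hest : cst * (p : ℝ) ^ ((m : ℝ) + 1 / B) ≤ ‖u + w‖ ^ 2 := by
      rw [hcst]
      rcases lt_or_gt_of_ne hbal with hlt | hgt
      · -- `2a < Bm`: `w` is the big root
        have h := sq_norm_add_ge_of_unbalanced hpp.two_le hBpos hpoww hpowu (A₁ := (B : ℤ) * m - a)
          (A₂ := a) (m := m) (by linarith) (by ring)
        rwa [add_comm w u] at h
      · -- `2a > Bm`: `u` is the big root
        exact sq_norm_add_ge_of_unbalanced hpp.two_le hBpos hpowu hpoww (A₁ := a)
          (A₂ := (B : ℤ) * m - a) (m := m) (by linarith) (by ring)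
    rw [hrankin _ p hpp hpN, ← hsum]
    have hexp : (p : ℝ) ^ ((m : ℝ) + 1 / B) * (p : ℝ) ^ (-s₀) = (p : ℝ) ^ (-1 + 1 / (2 * (B : ℝ))) := by
      rw [← Real.rpow_add hp0]
      congr 1
      rw [hs₀, hkm]
      field_simp
      ring
    calc cst * (p : ℝ) ^ (-1 + 1 / (2 * (B : ℝ)))
        = cst * (p : ℝ) ^ ((m : ℝ) + 1 / B) * (p : ℝ) ^ (-s₀) := by rw [mul_assoc, hexp]
      _ ≤ ‖u + w‖ ^ 2 * (p : ℝ) ^ (-s₀) :=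
          mul_le_mul_of_nonneg_right hest (Real.rpow_nonneg hp0.le _)

/-- **Ribet 1977, Thm. (2.3)** — discharge of the named fact `Ribet1977.thm23_isIrreducible`
(`NewformGaloisRepDeligneProofs.lean`): every `λ`-adic representation attached to a newform
`f ∈ S_k(Γ₁(N))`, `k ≥ 1`, away from `N ℓ` is irreducible over its coefficient field.  The module
topology of the finite extension `E/ℚ_ℓ` is the topology of the spectral norm
(`spectralNorm_topology_eq_moduleTopology`), so this is `thm23_normed`.
[cite: Ribet1977Nebentypus, Thm. (2.3)] -/
theorem thm23_isIrreducible_holds : thm23_isIrreducible (N := N) (k := k) := by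
  intro f hk hf ℓ _ E _ _ _ tE hmt ι ρ hρ
  haveI : Algebra.IsAlgebraic ℚ_[ℓ] E := Algebra.IsAlgebraic.of_finite ℚ_[ℓ] E
  have ht : tE =
      (spectralNorm.nontriviallyNormedField ℚ_[ℓ] E).toNormedField.toMetricSpace.toPseudoMetricSpace.toUniformSpace.toTopologicalSpace :=
    (IsModuleTopology.eq_moduleTopology' (R := ℚ_[ℓ]) (A := E)).trans
      (spectralNorm_topology_eq_moduleTopology ℓ E).symm
  subst ht
  letI nf : NontriviallyNormedField E := spectralNorm.nontriviallyNormedField ℚ_[ℓ] E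
  letI na : NormedAlgebra ℚ_[ℓ] E := spectralNorm.normedAlgebra ℚ_[ℓ] E
  haveI : IsUltrametricDist E :=
    IsUltrametricDist.isUltrametricDist_of_isNonarchimedean_norm isNonarchimedean_spectralNorm
  haveI : CompleteSpace E := FiniteDimensional.complete ℚ_[ℓ] E
  exact thm23_normed hk hf ℓ E ι ρ hρ

end Ribet1977


end Literature.NumberTheory.EllipticCurves.ModularForms

end
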